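import Mathlib.RingTheory.Filtration
import Mathlib.RingTheory.Ideal.IsPrimary
import Literature.NumberTheory.GaloisRepresentations.ModPGaloisRep
import Literature.NumberTheory.GaloisRepresentations.RamificationFiltrationProofs
import HarnessLib

/-!
# Discharges of named facts in `ModPGaloisRep.lean`: level two implies tame (trunk GalRep, item C15)

D-0014 keeps `Literature/` sorry-free by stating cited results as named facts `def X : Prop`.
This sibling file proves the fact

* `Literature.NumberTheory.GaloisRepresentations.ModPGaloisRep.HasLevelTwoInertiaShape.isTamelyRamified_holds` — a two-dimensional
  mod `p` representation `ρ̄_F` of the non-archimedean local field `F` whose restriction to the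
  inertia group `I_F` is `diag(ψ₂^{a+qb}, ψ₂^{qa+b})` (`HasLevelTwoInertiaShape`, `ψ₂` the
  level-two fundamental character) is tamely ramified: every upper-numbering group `I_F^v`,
  `v > 0`, acts trivially (Serre, Duke Math. J. 54 (1987), §2.1: the fundamental characters are
  characters of the *tame* inertia `I_t = I/I_p`),

of `Literature.NumberTheory.GaloisRepresentations.ModPGaloisRep` as a `theorem X_holds : X`
(users holding `(h : X)` are fed `X_holds`), together with the results it rests on, which are of
independent use:

* `Literature.NumberTheory.GaloisRepresentations.le_herbrandPsi`, `Literature.NumberTheory.GaloisRepresentations.upperRamificationSubgroup_le_ramificationSubgroup_one` — finite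
  level: `v ≤ ψ(v)` for `v ≥ 0`, hence `G^v ≤ G_1` for `v > 0` (Serre, *Local Fields*, Ch. IV
  §3, Prop. 12–13);
* `Literature.NumberTheory.GaloisRepresentations.sub_one_mem_of_map_eq_mul` — the algebra behind "`θ_0` kills `G_1`" (Serre, *Local
  Fields*, Ch. IV §2, Prop. 7): a ring endomorphism `f` of a noetherian domain with
  `f x ≡ x (mod Q²)` for all `x` (`Q` maximal) satisfies `c ≡ 1 (mod Q)` whenever `f z = c z`,
  `z ≠ 0`;
* `Literature.NumberTheory.GaloisRepresentations.kummerCharacter_apply_eq_one_of_mem_absUpperInertia`,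
  `Literature.NumberTheory.GaloisRepresentations.fundamentalCharacter_apply_eq_one_of_mem_absUpperInertia` — the Kummer characters
  `σ ↦ σ(z)/z (mod 𝔓)` (`z ^ n = a`, `n ≠ 0` in `F`), in particular Serre's fundamental
  characters `ψ_m`, are trivial on `I_F ∩ I_F^v` for every `v > 0` (Serre, Invent. Math. 15
  (1972), §1.3: `θ_d` is a character of `I_t = I/I_p`).

## Proof architecture

Serre (1972, §1.2–1.3; 1987, §2.1) works with the tame quotient `I_t = I/I_p`, `I_p` the wild
inertia (pro-`p`) group, and the characters `θ_d : I_t → μ_d`, `s(x^{1/d}) = θ_d(s) x^{1/d}`.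
In this library "tame" is phrased through the upper numbering (`IsTamelyRamified`: all `I_F^v`,
`v > 0`, act trivially) and the fundamental character is the reduction modulo
`𝔓 = absMaximalIdeal F` of the Kummer cocycle `σ(z)/z`; we therefore prove directly the
congruence `σ(z)/z ≡ 1 (mod Q)` for `σ ∈ I_F^v`, `v > 0`, and `Q ⊇ 𝔓` the prime of
`S = absIntegers 𝒪[F] F` cut out by the residue embedding `ι : S ⧸ 𝔓 → k` (the kernel of
`ι ∘ (mod 𝔓)`), which is exactly what `ψ_m(σ) = 1` in `kˣ` means.  Three steps:

1. *Finite level, Herbrand* (`le_herbrandPsi`).  For a finite group `G`, the integrand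
   `1/(G_0 : G_⌈t⌉)` of `φ(u) = ∫₀ᵘ dt/(G_0 : G_t)` lies in `[1/#G_0, 1]`, so
   `u/#G_0 ≤ φ(u) ≤ u` for `u ≥ 0` (Serre, Ch. IV §3, Prop. 12: `φ` is concave of slope
   `1/(G_0 : G_u) ≤ 1`); hence the set `{u | φ u ≤ v}` defining `ψ(v) = sSup …` contains `v` and
   is bounded by `v · #G_0`, so `v ≤ ψ(v)` and `G^v = G_{⌈ψ v⌉} ≤ G_1` for `v > 0`.
2. *Finite level, `G_1` acts unipotently* (`sub_mem_pow_succ_of_forall_sub_mem_sq`,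
   `sub_one_mem_of_map_eq_mul`).  If `τ x ≡ x (mod Q²)` for all `x` then, by induction on
   products, `τ w ≡ w (mod Q^{m+1})` for `w ∈ Q^m`; for `z ≠ 0` take `m` maximal with `z ∈ Q^m`
   (Krull's intersection theorem, Mathlib `Ideal.iInf_pow_eq_bot_of_isDomain`); then
   `(c - 1) z = τ z - z ∈ Q^{m+1}` with `z ∉ Q^{m+1}` and `Q^{m+1}` primary (`Q` maximal) force
   `c - 1 ∈ Q`.  This is the computation in the proof of Serre, Ch. IV §2, Prop. 7
   (`s(u)/u ≡ 1`, `s(π)/π ∈ U¹` for `s ∈ G_1`), arranged so as to need neither a uniformiser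
   nor the order of `c`.
3. *Passage to `F̄`* (`sub_one_mem_of_smul_eq_mul_of_mem_absUpperInertia`,
   `kummerCharacter_apply_eq_one_of_mem_absUpperInertia`).  `I_F^v` is defined (item C9) as the
   intersection over the finite normal subextensions `E/F` of `F̄` of the pull-backs of
   `Gal(E/F)^v` at `𝔓 ∩ E`.  Take for `E` the splitting field of `X^n - a` in `F̄` (Mathlib
   `IntermediateField.adjoin_rootSet_isSplittingField`; it is Galois since `n ≠ 0` in `F`,
   `Polynomial.separable_X_pow_sub_C`), which contains `z` and `σ z`.  Then `σ|_E ∈ Gal(E/F)^v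
   ≤ G_1` (step 1) gives `σ|_E x - x ∈ (𝔓 ∩ E)² ⊆ (Q ∩ E)²` on `𝒪_E = integralClosure 𝒪[F] E`,
   a Dedekind domain (Mathlib `IsIntegralClosure.isDedekindDomain`) in which `Q ∩ E` is maximal
   (it lies over `𝓂[F]`; going up, Mathlib `Ideal.isMaximal_of_isIntegral_of_isMaximal_comap`),
   and step 2 applied to `σ z = c z` gives `c - 1 ∈ Q`.  The (proved) equivariance of the
   inclusion `𝒪_E → S` (`IntermediateField.integralClosureToAbsIntegers_restrictNormalHom_smul`)
   and `I_F^v ≤ I_F` (`absUpperInertia_le_absInertia_holds`) do the bookkeeping.  For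
   `n = q^m - 1` the hypothesis `n ≠ 0` in `F` holds because the characteristic of `F` is `0` or
   the residue characteristic `p ∣ q` (`natCast_residueFieldCard_pow_sub_one_ne_zero`).

Finally a level-two shape `P ρ̄(σ) P⁻¹ = diag(ψ₂(σ)^{a+qb}, ψ₂(σ)^{qa+b})` with `ψ₂(σ) = 1`
gives `ρ̄(σ) = 1`.  Only Mathlib and proved results of `Literature/` are used; in particular
neither the maximality of `𝔓` nor any other henselian named fact of item C4 is needed.

## References

* J.-P. Serre, *Sur les représentations modulaires de degré 2 de `Gal(ℚ̄/ℚ)`*, Duke Math. J.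
  54 (1987), 179–230, §2.1 (`I_p` the largest pro-`p` subgroup of `I`, `I_t = I/I_p`; "un
  caractère de `I_t` sera dit de niveau `n` …"; Prop. 1), §2.2 (level two). [Serre1987]
* J.-P. Serre, *Propriétés galoisiennes des points d'ordre fini des courbes elliptiques*,
  Invent. Math. 15 (1972), 259–331, §1.2 (`I ⊃ I_p`, `I_t = I/I_p`), §1.3
  (`s(x^{1/d}) = θ_d(s) x^{1/d}`, `θ_d : Gal(K_d/K_nr) → μ_d`), §1.7 (fundamental characters).
  [SerreInventiones1972]
* J.-P. Serre, *Local Fields*, GTM 67, Springer 1979, Ch. IV §1 (Lemma 1: `G_i`), §2 (Prop. 7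
  and Cor. 1, 3: `θ_i : G_i/G_{i+1} ↪ U^i/U^{i+1}`, `G_1` is a `p`-group), §3 (φ, Prop. 12;
  `ψ = φ⁻¹`, Prop. 13; `G^v = G_{ψ(v)}`, `G^0 = G_0`; Remark 1: infinite extensions).
  [SerreLocalFields1979]
-/

noncomputable section

open MeasureTheory
open scoped Valued Pointwise
open Field ValuativeRel

namespace Literature.NumberTheory.GaloisRepresentations

universe u v

/-! ### Step 2 (algebra): an endomorphism congruent to the identity modulo `Q²` -/

section CommAlgebra

/-- If a ring endomorphism `f` of `B` satisfies `f x ≡ x (mod Q ^ 2)` for all `x`, then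
`f w ≡ w (mod Q ^ (m + 1))` for all `w ∈ Q ^ m` (induction on `m`:
`f (x y) - x y = (f x - x) f y + x (f y - y)`).  This is the mechanism of Serre's
`θ_i : G_i/G_{i+1} ↪ U^i/U^{i+1}` (for `s ∈ G_1`, `s(u)/u ≡ 1 (mod 𝔭)` and `s(π)/π ∈ U¹`).
Ref: Serre, *Local Fields*, Ch. IV §2, proof of Prop. 7. [folklore] -/
theorem sub_mem_pow_succ_of_forall_sub_mem_sq {B : Type*} [CommRing B] (Q : Ideal B)
    (f : B →+* B) (hf : ∀ x, f x - x ∈ Q ^ 2) :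
    ∀ (m : ℕ) {w : B}, w ∈ Q ^ m → f w - w ∈ Q ^ (m + 1) := by
  have hfQ : ∀ y ∈ Q, f y ∈ Q := fun y hy => by
    have h := hf y
    have : f y = (f y - y) + y := by ring
    rw [this]
    exact Q.add_mem (Ideal.pow_le_self two_ne_zero h) hy
  intro m
  induction m with
  | zero =>
    intro w _
    simpa using Ideal.pow_le_pow_right (show 1 ≤ 2 by norm_num) (hf w)
  | succ m ih =>
    intro w hw
    rw [pow_succ] at hw
    refine Submodule.mul_induction_on hw ?_ ?_
    · intro x hx y hy
      have key : f (x * y) - x * y = (f x - x) * f y + x * (f y - y) := by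
        rw [map_mul]; ring
      rw [key]
      refine Ideal.add_mem _ ?_ ?_
      · have h1 : (f x - x) * f y ∈ Q ^ (m + 1) * Q := Ideal.mul_mem_mul (ih hx) (hfQ y hy)
        rwa [← pow_succ] at h1
      · have h2 : x * (f y - y) ∈ Q ^ m * Q ^ 2 := Ideal.mul_mem_mul hx (hf y)
        rwa [← pow_add] at h2
    · intro x y hx hy
      have : f (x + y) - (x + y) = (f x - x) + (f y - y) := by rw [map_add]; ring
      rw [this]
      exact Ideal.add_mem _ hx hy

/-- **`G_1` acts with eigenvalues `≡ 1`.**  Let `B` be a noetherian domain, `Q` a maximal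
ideal, `f` a ring endomorphism with `f x ≡ x (mod Q ^ 2)` for all `x`.  If `z ≠ 0` and
`f z = c z` then `c ≡ 1 (mod Q)`.  Proof: by Krull's intersection theorem
(`Ideal.iInf_pow_eq_bot_of_isDomain`) there is a largest `m` with `z ∈ Q ^ m`; then
`(c - 1) z = f z - z ∈ Q ^ (m + 1)` (`sub_mem_pow_succ_of_forall_sub_mem_sq`) while
`z ∉ Q ^ (m + 1)`, and `Q ^ (m + 1)` is primary with radical `Q`.  (For `B` the valuation ring
of a local field, `z = π` a uniformiser and `f = s ∈ G_1`: `s(π)/π ≡ 1`, i.e. `θ_0(s) = 1`.)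
Ref: Serre, *Local Fields*, Ch. IV §2, Prop. 7 and Cor. 1. [folklore] -/
theorem sub_one_mem_of_map_eq_mul {B : Type*} [CommRing B] [IsNoetherianRing B] [IsDomain B]
    (Q : Ideal B) (hQ : Q.IsMaximal) (f : B →+* B) (hf : ∀ x, f x - x ∈ Q ^ 2)
    {z c : B} (hz : z ≠ 0) (hfz : f z = c * z) : c - 1 ∈ Q := by
  classical
  have hex : ∃ i : ℕ, z ∉ Q ^ i := by
    by_contra h
    push Not at h
    have hmem : z ∈ ⨅ i : ℕ, Q ^ i := Submodule.mem_iInf _ |>.mpr h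
    rw [Ideal.iInf_pow_eq_bot_of_isDomain Q hQ.ne_top, Ideal.mem_bot] at hmem
    exact hz hmem
  obtain ⟨e, he, hmin⟩ : ∃ e, z ∉ Q ^ e ∧ ∀ i < e, z ∈ Q ^ i :=
    ⟨Nat.find hex, Nat.find_spec hex, fun i hi => by simpa using Nat.find_min hex hi⟩
  have he0 : e ≠ 0 := by
    rintro rfl
    exact he (by simp)
  obtain ⟨e', rfl⟩ := Nat.exists_eq_succ_of_ne_zero he0
  have hz' : z ∈ Q ^ e' := hmin e' (Nat.lt_succ_self e')
  have h1 : f z - z ∈ Q ^ (e' + 1) := sub_mem_pow_succ_of_forall_sub_mem_sq Q f hf e' hz'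
  have h2 : f z - z = z * (c - 1) := by rw [hfz]; ring
  rw [h2] at h1
  have hrad : (Q ^ (e' + 1)).radical = Q := by
    rw [Ideal.radical_pow _ (Nat.succ_ne_zero e'), hQ.isPrime.radical]
  have hprim : (Q ^ (e' + 1)).IsPrimary := Ideal.isPrimary_of_isMaximal_radical (hrad.symm ▸ hQ)
  rcases (Ideal.isPrimary_iff.mp hprim).2 h1 with h | h
  · exact (he h).elim
  · rwa [hrad] at h

end CommAlgebra

/-! ### Step 1 (finite level): `v ≤ ψ(v)`, hence `G^v ≤ G_1` for `v > 0` -/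

section Herbrand

variable {S : Type*} [CommRing S] (𝔓 : Ideal S) (G : Type*) [Group G] [MulSemiringAction G S]

/-- For finite `G` the ramification groups have positive (real) cardinality. [folklore] -/
theorem card_ramificationSubgroup_pos [Finite G] (i : ℕ) :
    0 < (Nat.card (𝔓.ramificationSubgroup G i) : ℝ) :=
  Nat.cast_pos.mpr Nat.card_pos

/-- `#G_j ≤ #G_i` for `i ≤ j` (the filtration is decreasing; finite `G`).
Ref: Serre, *Local Fields*, Ch. IV §1, Prop. 1. [folklore] -/
theorem card_ramificationSubgroup_le [Finite G] {i j : ℕ} (h : i ≤ j) :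
    (Nat.card (𝔓.ramificationSubgroup G j) : ℝ) ≤ Nat.card (𝔓.ramificationSubgroup G i) :=
  Nat.cast_le.mpr (Subgroup.card_le_of_le (𝔓.ramificationSubgroup_antitone G h))

/-- The Herbrand integrand is `#G_⌈t⌉ / #G_0 = 1/(G_0 : G_⌈t⌉)`.
Ref: Serre, *Local Fields*, Ch. IV §3, definition of `φ`. [folklore] -/
theorem herbrandIntegrand_eq (t : ℝ) :
    herbrandIntegrand 𝔓 G t =
      (Nat.card (𝔓.ramificationSubgroup G ⌈t⌉₊) : ℝ) / Nat.card (𝔓.ramificationSubgroup G 0) := by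
  rw [herbrandIntegrand, inv_div]

/-- The Herbrand integrand is `≤ 1` (finite `G`): the slope of `φ` is `1/(G_0 : G_u) ≤ 1`.
Ref: Serre, *Local Fields*, Ch. IV §3, Prop. 12 c). [folklore] -/
theorem herbrandIntegrand_le_one [Finite G] (t : ℝ) : herbrandIntegrand 𝔓 G t ≤ 1 := by
  rw [herbrandIntegrand_eq, div_le_one (card_ramificationSubgroup_pos 𝔓 G 0)]
  exact card_ramificationSubgroup_le 𝔓 G (Nat.zero_le _)

-- `inv_card_le_herbrandIntegrand` (integrand `≥ 1/#G_0`) and `herbrandIntegrand_antitone`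
-- (integrand decreasing) are proved in `RamificationFiltrationProofs.lean`.

/-- `φ(u) ≤ u` for `u ≥ 0` (finite `G`): `φ(0) = 0` and the slope of `φ` is `≤ 1`.
Ref: Serre, *Local Fields*, Ch. IV §3, Prop. 12. [folklore] -/
theorem herbrandPhi_le_self [Finite G] {u : ℝ} (hu : 0 ≤ u) : herbrandPhi 𝔓 G u ≤ u := by
  have h := intervalIntegral.integral_mono_on (μ := volume) hu
    (herbrandIntegrand_antitone 𝔓 G).intervalIntegrable intervalIntegrable_const
    (fun t _ => herbrandIntegrand_le_one 𝔓 G t)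
  rw [intervalIntegral.integral_const, smul_eq_mul, mul_one, sub_zero] at h
  exact h

/-- `u / #G_0 ≤ φ(u)` for `u ≥ 0` (finite `G`): the slope of `φ` is `≥ 1/#G_0`.
Ref: Serre, *Local Fields*, Ch. IV §3, Prop. 12. [folklore] -/
theorem div_card_le_herbrandPhi [Finite G] {u : ℝ} (hu : 0 ≤ u) :
    u / Nat.card (𝔓.ramificationSubgroup G 0) ≤ herbrandPhi 𝔓 G u := by
  have h := intervalIntegral.integral_mono_on (μ := volume) hu intervalIntegrable_const
    (herbrandIntegrand_antitone 𝔓 G).intervalIntegrable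
    (fun t _ => inv_card_le_herbrandIntegrand 𝔓 G t)
  rw [intervalIntegral.integral_const, smul_eq_mul, sub_zero] at h
  rw [div_eq_mul_inv]
  exact h

/-- For `v ≥ 0` the set `{u | φ u ≤ v}` (whose supremum is `ψ v`) is bounded above by
`v · #G_0` (finite `G`).  Ref: Serre, *Local Fields*, Ch. IV §3, Prop. 12–13. [folklore] -/
theorem bddAbove_setOf_herbrandPhi_le [Finite G] {v : ℝ} (hv : 0 ≤ v) :
    BddAbove {u : ℝ | herbrandPhi 𝔓 G u ≤ v} := by
  refine ⟨v * Nat.card (𝔓.ramificationSubgroup G 0), fun u hu => ?_⟩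
  have hb : 0 ≤ v * Nat.card (𝔓.ramificationSubgroup G 0) :=
    mul_nonneg hv (card_ramificationSubgroup_pos 𝔓 G 0).le
  rcases le_or_gt u 0 with hu0 | hu0
  · exact hu0.trans hb
  · have h := (div_card_le_herbrandPhi 𝔓 G hu0.le).trans hu
    rwa [div_le_iff₀ (card_ramificationSubgroup_pos 𝔓 G 0)] at h

/-- **`v ≤ ψ(v)` for `v ≥ 0`** (finite `G`): `ψ = φ⁻¹` is convex with `ψ(0) = 0` and slopes
`(G_0 : G_u) ≥ 1`.  With `herbrandPsi 𝔓 G v = sSup {u | φ u ≤ v}`: the set contains `v`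
(`herbrandPhi_le_self`) and is bounded above (`bddAbove_setOf_herbrandPhi_le`).
Ref: Serre, *Local Fields*, Ch. IV §3, Prop. 13 a)–c). [folklore] -/
theorem le_herbrandPsi [Finite G] {v : ℝ} (hv : 0 ≤ v) : v ≤ herbrandPsi 𝔓 G v :=
  le_csSup (bddAbove_setOf_herbrandPhi_le 𝔓 G hv) (herbrandPhi_le_self 𝔓 G hv)

/-- `⌈ψ(v)⌉ ≥ 1` for `v > 0` (finite `G`).  Ref: Serre, *Local Fields*, Ch. IV §3,
Prop. 13. [folklore] -/
theorem one_le_ceil_herbrandPsi [Finite G] {v : ℝ} (hv : 0 < v) : 1 ≤ ⌈herbrandPsi 𝔓 G v⌉₊ :=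
  Nat.one_le_ceil_iff.mpr (hv.trans_le (le_herbrandPsi 𝔓 G hv.le))

/-- **`G^v ≤ G_1` for `v > 0`** (finite `G`): `G^v = G_{⌈ψ v⌉}` with `⌈ψ v⌉ ≥ 1`, and the
lower filtration is decreasing.  (Serre: `G^0 = G_0` and `G^v`, `v > 0`, lies in the wild
inertia group `G_1`.)  Ref: Serre, *Local Fields*, Ch. IV §3 (definition of the upper
numbering, after Prop. 13) and §1, Prop. 1. [folklore] -/
theorem upperRamificationSubgroup_le_ramificationSubgroup_one [Finite G] {v : ℝ} (hv : 0 < v) :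
    upperRamificationSubgroup 𝔓 G v ≤ 𝔓.ramificationSubgroup G 1 :=
  𝔓.ramificationSubgroup_antitone G (one_le_ceil_herbrandPsi 𝔓 G hv)

end Herbrand

/-! ### Step 3: Kummer characters are trivial on `I_F ∩ I_F^v`, `v > 0` -/

section Local

open GaloisRepresentations.IsNonarchimedeanLocalField

variable (F : Type u) [Field F] [ValuativeRel F] [TopologicalSpace F] [IsNonarchimedeanLocalField F]

/-- `q ^ m - 1 ≠ 0` in `F` for `m ≠ 0` (`q = residueFieldCard F`): the characteristic of `F` is
either `0` or a prime `ℓ`; in the latter case `ℓ = 0` in `𝓀[F]`, so `ℓ` is the residue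
characteristic `p`, and `p ∣ q ^ m`, `p ∣ q ^ m - 1` would give `p ∣ 1`.
Ref: Serre, *Local Fields*, Ch. II §4–5 (equal and unequal characteristic). [folklore] -/
theorem natCast_residueFieldCard_pow_sub_one_ne_zero {m : ℕ} (hm : m ≠ 0) :
    ((residueFieldCard F ^ m - 1 : ℕ) : F) ≠ 0 := by
  classical
  intro h
  letI := Fintype.ofFinite 𝓀[F]
  obtain ⟨f, hp, hf⟩ := FiniteField.card 𝓀[F] (ringChar 𝓀[F])
  have hq : residueFieldCard F = ringChar 𝓀[F] ^ (f : ℕ) := by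
    rw [residueFieldCard, Nat.card_eq_fintype_card, hf]
  have hqm : 1 ≤ residueFieldCard F ^ m :=
    Nat.one_le_pow _ _ (zero_lt_one.trans (one_lt_residueFieldCard F))
  -- `ℓ = ringChar F` divides `q ^ m - 1`
  have hdvd : ringChar F ∣ residueFieldCard F ^ m - 1 := (ringChar.spec F _).mp h
  rcases CharP.char_is_prime_or_zero F (ringChar F) with hℓ | hℓ
  · -- `ℓ` prime: then `ℓ = p`, the residue characteristic, and `p ∣ q ^ m`, so `p ∣ 1`
    have hℓO : ((ringChar F : ℕ) : 𝒪[F]) = 0 := by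
      apply Subtype.val_injective
      rw [SubringClass.coe_natCast]
      exact ringChar.Nat.cast_ringChar
    have hℓk : ((ringChar F : ℕ) : 𝓀[F]) = 0 := by
      rw [← map_natCast (IsLocalRing.residue 𝒪[F]), hℓO, map_zero]
    have hpℓ : ringChar 𝓀[F] ∣ ringChar F := (ringChar.spec 𝓀[F] _).mp hℓk
    have hpeq : ringChar 𝓀[F] = ringChar F := (Nat.prime_dvd_prime_iff_eq hp hℓ).mp hpℓ
    have h1 : ringChar F ∣ residueFieldCard F ^ m := by
      rw [hq, hpeq, ← pow_mul]
      exact dvd_pow_self _ (mul_ne_zero (PNat.ne_zero f) hm)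
    have h2 : ringChar F ∣ 1 := by
      have := Nat.dvd_sub h1 hdvd
      rwa [Nat.sub_sub_self hqm] at this
    exact hℓ.one_lt.ne' (Nat.dvd_one.mp h2)
  · -- `ℓ = 0`: `F` has characteristic zero
    rw [hℓ, zero_dvd_iff] at hdvd
    have := one_lt_pow₀ (one_lt_residueFieldCard F) hm
    omega

variable {F}

/-- **Finite level: wild inertia acts with eigenvalues `≡ 1 (mod Q)`.**  Let `E/F` be a
finite Galois subextension of `F̄`, `Q ⊇ 𝔓 = absMaximalIdeal F` a prime of
`S = absIntegers 𝒪[F] F`, `σ ∈ I_F^v` with `v > 0`, and `x, c ∈ S ∩ E` with `x ≠ 0` and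
`σ x = c x`.  Then `c ≡ 1 (mod Q)`.
Proof: `σ|_E ∈ Gal(E/F)^v ≤ G_1` at `𝔓 ∩ E` (definition of `I_F^v`, item C9, and
`upperRamificationSubgroup_le_ramificationSubgroup_one`), i.e. `σ|_E y - y ∈ (𝔓 ∩ E)² ⊆
(Q ∩ E)²` on the Dedekind domain `𝒪_E = integralClosure 𝒪[F] E`
(`IsIntegralClosure.isDedekindDomain`), where `Q ∩ E` is maximal (`Q` lies over `𝓂[F]`, going
up); conclude by `sub_one_mem_of_map_eq_mul` and the equivariance of `𝒪_E → S`
(`IntermediateField.integralClosureToAbsIntegers_restrictNormalHom_smul`).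
Ref: Serre, *Local Fields*, Ch. IV §2, Prop. 7 and Cor. 1 (`θ_0` is trivial on `G_1`), §3
(`G^v`, Remark 1 for infinite extensions); Serre, Invent. Math. 15 (1972), §1.3.
[cite: SerreLocalFields1979, Ch. IV §2 Prop. 7, Cor. 1; Ch. IV §3] -/
theorem sub_one_mem_of_smul_eq_mul_of_mem_absUpperInertia
    (E : IntermediateField F (AlgebraicClosure F)) [FiniteDimensional F E] [Normal F E]
    [Algebra.IsSeparable F E]
    (Q : Ideal (absIntegers 𝒪[F] F)) [Q.IsPrime] (hPQ : absMaximalIdeal F ≤ Q)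
    {v : ℝ} (hv : 0 < v) {σ : absoluteGaloisGroup F} (hσ : σ ∈ absUpperInertia F v)
    {x c : absIntegers 𝒪[F] F} (hxE : (x : AlgebraicClosure F) ∈ E)
    (hcE : (c : AlgebraicClosure F) ∈ E) (hx : x ≠ 0) (hσx : σ • x = c * x) :
    c - 1 ∈ Q := by
  haveI : IsDedekindDomain (integralClosure 𝒪[F] E) :=
    IsIntegralClosure.isDedekindDomain 𝒪[F] F E (integralClosure 𝒪[F] E)
  -- `Q` is maximal: it lies over `𝓂[F]` and `S / 𝒪[F]` is integral
  have hQmax : Q.IsMaximal := by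
    refine Ideal.isMaximal_of_isIntegral_of_isMaximal_comap (R := 𝒪[F]) Q ?_
    have hle : 𝓂[F] ≤ Q.comap (algebraMap 𝒪[F] (absIntegers 𝒪[F] F)) := fun y hy =>
      hPQ (Ideal.le_radical (Ideal.mem_map_of_mem _ hy))
    have hne : Q.comap (algebraMap 𝒪[F] (absIntegers 𝒪[F] F)) ≠ ⊤ :=
      (Ideal.comap_isPrime _ Q).ne_top
    rw [← (IsLocalRing.maximalIdeal.isMaximal 𝒪[F]).eq_of_le hne hle]
    exact IsLocalRing.maximalIdeal.isMaximal 𝒪[F]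
  -- hence `Q_E = Q ∩ 𝒪_E` is maximal (`S` is integral over `𝒪_E`)
  have hQEmax : (Q.comap (E.integralClosureToAbsIntegers 𝒪[F])).IsMaximal := by
    haveI := hQmax
    refine Ideal.isMaximal_comap_of_isIntegral_of_isMaximal'
      (E.integralClosureToAbsIntegers 𝒪[F] : integralClosure 𝒪[F] E →+* absIntegers 𝒪[F] F) ?_ Q
    refine RingHom.IsIntegral.tower_top (algebraMap 𝒪[F] (integralClosure 𝒪[F] E)) _ ?_
    intro y
    rw [AlgHom.comp_algebraMap]
    exact Algebra.IsIntegral.isIntegral y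
  -- the restriction `τ = σ|_E` lies in `Gal(E/F)^v ≤ G_1` (at `𝔓 ∩ E`)
  have hτ : absRestrictNormalHom E σ ∈
      ((absMaximalIdeal F).comap (E.integralClosureToAbsIntegers 𝒪[F])).ramificationSubgroup
        (E ≃ₐ[F] E) 1 :=
    upperRamificationSubgroup_le_ramificationSubgroup_one _ _ hv
      (mem_absUpperRamificationSubgroup_iff.mp hσ E)
  have hfQ : ∀ y, MulSemiringAction.toRingHom (E ≃ₐ[F] E) (integralClosure 𝒪[F] E)
      (absRestrictNormalHom E σ) y - y ∈ (Q.comap (E.integralClosureToAbsIntegers 𝒪[F])) ^ 2 :=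
    fun y => by
    rw [MulSemiringAction.toRingHom_apply]
    exact Ideal.pow_right_mono (Ideal.comap_mono hPQ) 2
      ((Ideal.mem_ramificationSubgroup_iff.mp hτ).2 y)
  -- `x` and `c` come from `𝒪_E`
  have hinj : Function.Injective ((E.val).restrictScalars 𝒪[F]) := fun a b h => Subtype.ext h
  obtain ⟨xE, hιx⟩ : ∃ xE : integralClosure 𝒪[F] E, E.integralClosureToAbsIntegers 𝒪[F] xE = x :=
    ⟨⟨⟨x, hxE⟩, (isIntegral_algHom_iff ((E.val).restrictScalars 𝒪[F]) hinj).mp x.2⟩,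
      Subtype.ext rfl⟩
  obtain ⟨cE, hιc⟩ : ∃ cE : integralClosure 𝒪[F] E, E.integralClosureToAbsIntegers 𝒪[F] cE = c :=
    ⟨⟨⟨c, hcE⟩, (isIntegral_algHom_iff ((E.val).restrictScalars 𝒪[F]) hinj).mp c.2⟩,
      Subtype.ext rfl⟩
  have hxE0 : xE ≠ 0 := by
    rintro rfl
    rw [map_zero] at hιx
    exact hx hιx.symm
  -- `τ • xE = cE * xE`, transported from `σ • x = c * x` along the equivariant inclusion
  have hfx : MulSemiringAction.toRingHom (E ≃ₐ[F] E) (integralClosure 𝒪[F] E)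
      (absRestrictNormalHom E σ) xE = cE * xE := by
    rw [MulSemiringAction.toRingHom_apply]
    apply E.integralClosureInclusion_injective 𝒪[F]
    refine (E.integralClosureToAbsIntegers_restrictNormalHom_smul 𝒪[F] σ xE).trans ?_
    rw [map_mul]
    erw [hιx, hιc]
    exact hσx
  have key := sub_one_mem_of_map_eq_mul _ hQEmax _ hfQ hxE0 hfx
  rw [Ideal.mem_comap, map_sub, map_one, hιc] at key
  exact key

/-- **Kummer characters are trivial on `I_F ∩ I_F^v`, `v > 0`.**  For `a ∈ 𝒪[F] ∖ {0}`,
`n > 0` with `n ≠ 0` in `F`, a residue embedding `ι : S ⧸ 𝔓 →+* k`, and `σ ∈ I_F` lying in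
some `I_F^v` with `v > 0`: `kummerCharacter F hn ha ι σ = 1`, i.e. `σ(z)/z ≡ 1` modulo the
prime `Q = ker (ι ∘ mod 𝔓) ⊇ 𝔓` (`z = kummerRoot`, `z ^ n = a`).  (Serre: `θ_d` is a character
of the tame quotient `I_t = I/I_p`; here in the congruence form, valid for all `n ≠ 0` in `F`.)
Proof: apply `sub_one_mem_of_smul_eq_mul_of_mem_absUpperInertia` in the splitting field `E` of
`X ^ n - a` inside `F̄` (Galois, as `X ^ n - a` is separable), which contains `z` and `σ z`.
Ref: Serre, Invent. Math. 15 (1972), §1.2–1.3 (`I_p`, `I_t`, `θ_d`); Serre, *Local Fields*,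
Ch. IV §2, Cor. 1 and 3 of Prop. 7.
[cite: SerreInventiones1972, §1.3] [cite: SerreLocalFields1979, Ch. IV §2 Prop. 7 Cor. 1] -/
theorem kummerCharacter_apply_eq_one_of_mem_absUpperInertia {n : ℕ} (hn : 0 < n) {a : 𝒪[F]}
    (ha : a ≠ 0) (hnF : ((n : ℕ) : F) ≠ 0) {k : Type v} [Field k]
    (ι : absIntegers 𝒪[F] F ⧸ absMaximalIdeal F →+* k)
    {v : ℝ} (hv : 0 < v) (σ : absInertia F)
    (hσ : (σ : absoluteGaloisGroup F) ∈ absUpperInertia F v) :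
    kummerCharacter F hn ha ι σ = 1 := by
  -- reduce to `c - 1 ∈ Q`, `Q = ker (ι ∘ mk) ⊇ 𝔓` a prime of `S`, `c` the Kummer cocycle
  haveI hQ : (RingHom.ker (ι.comp (Ideal.Quotient.mk (absMaximalIdeal F)))).IsPrime :=
    RingHom.ker_isPrime _
  have hPQ : absMaximalIdeal F ≤ RingHom.ker (ι.comp (Ideal.Quotient.mk (absMaximalIdeal F))) :=
    fun y hy => by
    rw [RingHom.mem_ker, RingHom.comp_apply, Ideal.Quotient.eq_zero_iff_mem.mpr hy, map_zero]
  suffices h : kummerCocycleInt F hn ha σ - 1 ∈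
      RingHom.ker (ι.comp (Ideal.Quotient.mk (absMaximalIdeal F))) by
    ext
    rw [RingHom.mem_ker, RingHom.comp_apply, map_sub, map_one, map_sub, map_one, sub_eq_zero] at h
    rw [coe_kummerCharacter_apply, Units.val_one]
    exact h
  -- the splitting field `E` of `X ^ n - a` inside `F̄`: finite, normal, separable (`n ≠ 0` in `F`)
  have ha' : algebraMap 𝒪[F] F a ≠ 0 := fun h => ha (Subtype.val_injective (by simpa using h))
  have hp : (Polynomial.X ^ n - Polynomial.C (algebraMap 𝒪[F] F a) : Polynomial F) ≠ 0 :=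
    Polynomial.X_pow_sub_C_ne_zero hn _
  have hsep : (Polynomial.X ^ n - Polynomial.C (algebraMap 𝒪[F] F a) : Polynomial F).Separable :=
    Polynomial.separable_X_pow_sub_C _ hnF ha'
  haveI hSF := IntermediateField.adjoin_rootSet_isSplittingField
    (IsAlgClosed.splits ((Polynomial.X ^ n - Polynomial.C (algebraMap 𝒪[F] F a) :
      Polynomial F).map (algebraMap F (AlgebraicClosure F))))
  haveI : Normal F (IntermediateField.adjoin F ((Polynomial.X ^ n -
      Polynomial.C (algebraMap 𝒪[F] F a) : Polynomial F).rootSet (AlgebraicClosure F))) :=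
    Normal.of_isSplittingField
      (Polynomial.X ^ n - Polynomial.C (algebraMap 𝒪[F] F a) : Polynomial F)
  haveI : FiniteDimensional F (IntermediateField.adjoin F ((Polynomial.X ^ n -
      Polynomial.C (algebraMap 𝒪[F] F a) : Polynomial F).rootSet (AlgebraicClosure F))) :=
    Polynomial.IsSplittingField.finiteDimensional _
      (Polynomial.X ^ n - Polynomial.C (algebraMap 𝒪[F] F a) : Polynomial F)
  haveI : IsGalois F (IntermediateField.adjoin F ((Polynomial.X ^ n -
      Polynomial.C (algebraMap 𝒪[F] F a) : Polynomial F).rootSet (AlgebraicClosure F))) :=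
    IsGalois.of_separable_splitting_field hsep
  -- `z ∈ E`, `σ z ∈ E` (normality), hence `c = σ z / z ∈ E`
  have hz : ((kummerRoot F hn a : absIntegers 𝒪[F] F) : AlgebraicClosure F) ∈
      IntermediateField.adjoin F ((Polynomial.X ^ n -
        Polynomial.C (algebraMap 𝒪[F] F a) : Polynomial F).rootSet (AlgebraicClosure F)) := by
    apply IntermediateField.subset_adjoin
    rw [Polynomial.mem_rootSet]
    refine ⟨hp, ?_⟩
    rw [map_sub, map_pow, Polynomial.aeval_X, Polynomial.aeval_C, coe_kummerRoot_pow,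
      IsScalarTower.algebraMap_apply 𝒪[F] F (AlgebraicClosure F), sub_self]
  have hσz : (σ : absoluteGaloisGroup F) • ((kummerRoot F hn a : absIntegers 𝒪[F] F) :
      AlgebraicClosure F) ∈ IntermediateField.adjoin F ((Polynomial.X ^ n -
        Polynomial.C (algebraMap 𝒪[F] F a) : Polynomial F).rootSet (AlgebraicClosure F)) := by
    rw [absoluteGaloisGroup.smul_def, ← AlgEquiv.restrictNormalHom_apply _
      (absoluteGaloisGroup.toAlgEquiv F σ) ⟨_, hz⟩]
    exact SetLike.coe_mem _
  have hc : (kummerCocycleInt F hn ha σ : AlgebraicClosure F) ∈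
      IntermediateField.adjoin F ((Polynomial.X ^ n -
        Polynomial.C (algebraMap 𝒪[F] F a) : Polynomial F).rootSet (AlgebraicClosure F)) :=
    div_mem hσz hz
  refine sub_one_mem_of_smul_eq_mul_of_mem_absUpperInertia _ _ hPQ hv hσ hz hc
    (fun h => coe_kummerRoot_ne_zero hn ha (congrArg Subtype.val h)) ?_
  -- `σ • z = c * z` in `S`
  refine Subtype.ext ?_
  rw [integralClosure.coe_smul, Subalgebra.coe_mul, coe_kummerCocycleInt, kummerCocycle,
    div_mul_cancel₀ _ (coe_kummerRoot_ne_zero hn ha)]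

variable (F) in
/-- **The fundamental characters are tame**: `ψ_m(σ) = 1` for `σ ∈ I_F` lying in some `I_F^v`,
`v > 0` (`m ≠ 0`; `ψ_m = fundamentalCharacter F m ι ϖ hϖ`, the Kummer character of
`z ^ (q ^ m - 1) = ϖ`, and `q ^ m - 1 ≠ 0` in `F` by
`natCast_residueFieldCard_pow_sub_one_ne_zero`).
Serre: the fundamental characters of level `m` are characters of the tame inertia
`I_t = I/I_p`.
Ref: Serre, Invent. Math. 15 (1972), §1.3, §1.7; Serre, Duke Math. J. 54 (1987), §2.1.
[cite: SerreInventiones1972, §1.3 and §1.7] [cite: Serre1987, §2.1] -/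
theorem fundamentalCharacter_apply_eq_one_of_mem_absUpperInertia {k : Type v} [Field k] {m : ℕ}
    (hm : m ≠ 0) (ι : absIntegers 𝒪[F] F ⧸ absMaximalIdeal F →+* k) (ϖ : 𝒪[F])
    (hϖ : Irreducible ϖ) {v : ℝ} (hv : 0 < v) (σ : absInertia F)
    (hσ : (σ : absoluteGaloisGroup F) ∈ absUpperInertia F v) :
    fundamentalCharacter F m ι ϖ hϖ σ = 1 := by
  rw [fundamentalCharacter_of_ne_zero F hm]
  exact kummerCharacter_apply_eq_one_of_mem_absUpperInertia _ hϖ.ne_zero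
    (natCast_residueFieldCard_pow_sub_one_ne_zero F hm) ι hv σ hσ

/-! ### The discharge: level two implies tame -/

/-- **Discharge of `Literature.NumberTheory.GaloisRepresentations.ModPGaloisRep.HasLevelTwoInertiaShape.isTamelyRamified`.**  A
two-dimensional mod `p` representation `ρ̄_F` with level-two inertia shape
`P ρ̄(σ) P⁻¹ = diag(ψ₂(σ)^{a+qb}, ψ₂(σ)^{qa+b})` (`σ ∈ I_F`) is tamely ramified: for `v > 0`
and `σ ∈ I_F^v` we have `σ ∈ I_F` (`absUpperInertia_le_absInertia_holds`) and `ψ₂(σ) = 1`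
(`fundamentalCharacter_apply_eq_one_of_mem_absUpperInertia`), so `P ρ̄(σ) P⁻¹ = 1` and
`ρ̄(σ) = 1`.  Serre: the characters `φ, φ'` of level two describe the action of the tame
inertia `I_t = I/I_p` on `V^{ss} = V`, so `I_p` acts trivially.
Ref: Serre, Duke Math. J. 54 (1987), §2.1 (Prop. 1 and the preceding paragraph: "`I_p` agit
trivialement sur `V^{ss}`"), §2.2; Serre, Invent. Math. 15 (1972), §1.3, §1.7.
[cite: Serre1987, §2.1 Prop. 1, §2.2] [cite: SerreInventiones1972, §1.7] -/
theorem ModPGaloisRep.HasLevelTwoInertiaShape.isTamelyRamified_holds {k : Type v} [Field k]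
    [TopologicalSpace k] :
    ModPGaloisRep.HasLevelTwoInertiaShape.isTamelyRamified (F := F) (k := k) := by
  intro ρ ι ϖ hϖ a b h v hv σ hσ
  obtain ⟨P, hP⟩ := h
  have hσI : σ ∈ absInertia F := absUpperInertia_le_absInertia_holds F v hσ
  have hψ : fundamentalCharacter F 2 ι ϖ hϖ ⟨σ, hσI⟩ = 1 :=
    fundamentalCharacter_apply_eq_one_of_mem_absUpperInertia F two_ne_zero ι ϖ hϖ hv ⟨σ, hσI⟩ hσ
  have hmat := hP ⟨σ, hσI⟩
  rw [hψ, one_pow, one_pow, Units.val_one, ← Matrix.one_fin_two] at hmat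
  have h1 : P * ρ σ * P⁻¹ = 1 := Units.val_eq_one.mp hmat
  calc ρ σ = P⁻¹ * (P * ρ σ * P⁻¹) * P := by group
    _ = 1 := by rw [h1, mul_one, inv_mul_cancel]

end Local

end Literature.NumberTheory.GaloisRepresentations
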